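import Literature.Probability.RandomPlanarGeometry.HexSAWSurfaceWallBridges
import Literature.Probability.RandomPlanarGeometry.HexSAWArmchairWallBridges
import Literature.Probability.RandomPlanarGeometry.HexSAWHammersleyWelshLog
import HarnessLib

/-!
# Honeycomb SAW at the Duminil-Copin–Smirnov surface (brick-wall frame): the adsorbed phase is entropy-free at leading order —
# `√y ≤ β(y) ≤ √y / (1 − 36/√y)` for `y > 36²`, hence `β(y)/√y → 1` as `y → ∞`

Topic `Literature/Probability/RandomPlanarGeometry` (lane «pcv-sawmu», rider «WALL-SQRT-ASYMPTOTIC» — the DCS-frame twin of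
`HexSAWArmchairSqrtAsymptotic.lean`; continues `HexSAWSurfaceWallBridges.lean` (S1 Part I) — classes `hpw`/`archs`/`wbr`, weights
`Cw`/`Aw`/`WB`, `visits` (EVEN times `i ≥ 1` with `Y_i = 0`), the last-visit split `Wall.sum_fibre_lastV_le`, the Fekete rate `wallRate y = β(y)`
with `WB_le_pow : B^w_m(y) ≤ (β²/y) βᵐ`; `Arm.step_cases` of `HexSAWArmchairWallBridges.lean`; `hexSawCount_one_le` of `HexSAWHammersleyWelshLog.lean`).

Sources. N. R. Beaton, M. Bousquet-Mélou, J. de Gier, H. Duminil-Copin, A. J. Guttmann, *The critical fugacity for surface adsorption of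
self-avoiding walks on the honeycomb lattice is `1 + √2`*, CMP 326 (2014) = arXiv:1109.0358v5, §3.1, Proposition 5 (p. 9: existence and
properties of `μ(y)`; "walks sticking to the surface").  J. M. Hammersley, G. M. Torrie, S. G. Whittington, J. Phys. A 15 (1982) 539 (surface
free energy of `ℤ^d`; every "§2" locator below is PROVISIONAL — source not held, acq-10393; as summarised by Beaton 2014 p. 11 / BGJ12 p. 2).
G. Rychlewski, S. G. Whittington, J. Stat. Phys. 145 (2011) 661–668 (`μ(y) ∼ y` on the square lattice; not held).
N. Madras, G. Slade, *The Self-Avoiding Walk* (1993), §1.2 ((1.2.3); Lemma 1.2.2 p. 9; (1.2.17) p. 11).  I. G. Enting, I. Jensen, LNP 775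
(2009), §7.4.2, Fig. 7.10 (brickwork form of the honeycomb lattice).

## What is proved (namespace `…SAW.HexBW.Wall`; `y ≥ 1` unless stated)

In the brick-wall frame the DCS surface is the row `Y = 0`; its SURFACE VERTICES are the even-time vertices `(2s, 0)` of a walk from `0`,
which have no downward bond, so every arch ends `(x', 0) → (x, 0)` along the row, and the vertex before is either the previous surface
vertex `(2x'−x, 0)` (the STRAIGHT block, forced) or `(x', −1)` (return from an excursion):

* `sum_fibW_self_le : Σ_{straight fibre} ≤ y · A_{m+2}(y)`, `sum_fibW_le : Σ_{fibre k} ≤ 2y · A_k(y) · c_{m+3−k}(ℍ)`,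
  **`Aw_le_rec : A_{m+4}(y) ≤ y A_{m+2}(y) + 2y Σ_{k ≤ m+1} A_k(y) c_{m+3−k}(ℍ)`**;
* **`Aw_le_mul_pow`**: `1 ≤ y`, `6 ≤ ρ`, `y/ρ² + 36 y/ρ³ ≤ 1 ⇒ A_n(y) ≤ 27 y³ ρⁿ` (strong induction, `c_m(ℍ) ≤ 3^m`);
* `wallRate_le_of_WB_le` (Fekete), **`wallRate_le_sqrt_div (36² < y) : β(y) ≤ √y / (1 − 36/√y)`**, `one_le_wallRate_div_sqrt (0 < y)`,
  **`tendsto_wallRate_div_sqrt : β(y)/√y → 1`**, `tendsto_log_wallRate_sub_half_log : log β(y) − ½ log y → 0`.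

By the HOME addendum `HexSAWSurfaceWallRateEq.lean` (a-idea-1 g21) `β(y)` IS Prop. 5's `μ(y)` for every `y > 0`.  Status in print: BBdGDCG14
prove the lower bound ("the lower bound `μ(y) ≥ √y` is obtained by counting zig-zag walks sticking to the surface", arXiv v5 pp. 9–10) and STATE
the asymptotics WITHOUT PROOF: "The behaviour of `μ(y)` as `y → ∞` has recently been established by Rychlewski and Whittington [23], who proved
that, on the square lattice, `μ(y)` is asymptotic to `y`. This translates into `μ(y) ∼ √y` in our honeycomb setting." (v5 p. 10; [23] = J. Stat.
Phys. 145 (2011) 661–668, not held).  This file PROVES that printed remark for the wall-bridge rate `β(y)` of the brick-wall frame, with the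
explicit window `√y ≤ β(y) ≤ √y/(1 − 36/√y)` (`y > 36²`).  LABEL (author's proposal): CONSOLIDATION WITH PROOF of a printed-without-proof
remark, explicit rate new in writing (XS); elementary.
EDITIONS: ed.1 d41d7afc491a70e8; ed.2 650fc664a1fb518c = ed.1 + the status-in-print paragraph rewritten after lit-1 g16's reading of BBdGDCG p. 10
and two cite tags; ed.3 (this) = ed.2 + docstrings on the four private helpers (gate lint `lint.docstring` fires on private theorems too) —
all DOCSTRING-ONLY, code-identical to ed.1.
-/

noncomputable section

open Finset Filter Function
open Literature.Probability.LatticeModels Literature.Probability.Percolation SimpleGraph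
open _root_.Topology

namespace Literature.Probability.RandomPlanarGeometry.SAW.HexBW.Wall

variable {y : ℝ} {n : ℕ} {ω : ℕ → Site 2}

/-! ### Elementary counts and prefix bookkeeping -/

/-- `c_m(ℍ) ≤ 3^m` (private twin of the armchair file's lemma). [cite: MadrasSlade1993, §1.2, (1.2.3)] -/
private theorem hexSawCount_le_three_pow_aux (m : ℕ) : hexSawCount m ≤ 3 ^ m := by
  induction m with
  | zero => simp [hexSawCount_zero]
  | succ m ih =>
    calc hexSawCount (m + 1) ≤ hexSawCount m * hexSawCount 1 := hexSawCount_add_le m 1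
      _ ≤ 3 ^ m * 3 := Nat.mul_le_mul ih hexSawCount_one_le
      _ = 3 ^ (m + 1) := by ring

/-- `#(saws m) ≤ 3^m` as reals (private twin). [cite: MadrasSlade1993, §1.2, (1.2.3)] -/
private theorem card_saws_le_three_pow_aux (m : ℕ) : (#(saws m) : ℝ) ≤ 3 ^ m := by
  rw [card_saws]; exact_mod_cast hexSawCount_le_three_pow_aux m

/-- A priori bound: `A_m(y) ≤ #(saws m) · max(1,y)^m` (at most `m` visits). [cite: MadrasSlade1993, §1.2, (1.2.3)] -/
theorem Aw_le_card_mul_pow (m : ℕ) (hy : 0 ≤ y) : Aw m y ≤ #(saws m) * max 1 y ^ m := by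
  calc Aw m y ≤ ∑ ω ∈ archs m, max 1 y ^ m := Finset.sum_le_sum fun ω _ => by
        calc y ^ visits m ω ≤ max 1 y ^ visits m ω := pow_le_pow_left₀ hy (le_max_right _ _) _
          _ ≤ max 1 y ^ m := pow_le_pow_right₀ (le_max_left _ _) (visits_le m ω)
    _ = #(archs m) * max 1 y ^ m := by rw [Finset.sum_const, nsmul_eq_mul]
    _ ≤ #(saws m) * max 1 y ^ m := by
        gcongr
        exact archs_subset.trans hpw_subset

/-- Extensionality for `n`-step walks frozen after `n` (private twin). [cite: MadrasSlade1993, §1.1] -/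
private theorem eq_of_agree_aux (hω : ω ∈ saws n) {ξ : ℕ → Site 2} (hξ : ξ ∈ saws n) (h : ∀ i ≤ n, ω i = ξ i) : ω = ξ := by
  obtain ⟨-, hfr, -, -⟩ := mem_saws_iff.1 hω
  obtain ⟨-, hfr', -, -⟩ := mem_saws_iff.1 hξ
  funext i
  rcases Nat.lt_or_ge n i with hi | hi
  · rw [hfr i hi.le, hfr' i hi.le, h n le_rfl]
  · exact h i hi

/-- `lastV` only reads times `≤ m`: it agrees on the prefix walk. [cite: HammersleyTorrieWhittington1982, §2 (unfolded surface walks, as summarised by Beaton 2014 arXiv v3 p. 11; locator provisional, source not held)] -/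
theorem lastV_prefixWalk_eq (m : ℕ) (ξ : ℕ → Site 2) : lastV m (Zd.prefixWalk m ξ) = lastV m ξ := by
  unfold lastV
  have key : ∀ j ≤ m, Nat.findGreatest (fun i => i % 2 = 0 ∧ Zd.prefixWalk m ξ i 1 = 0) j =
      Nat.findGreatest (fun i => i % 2 = 0 ∧ ξ i 1 = 0) j := by
    intro j hj
    induction j with
    | zero => rfl
    | succ j ih =>
      rw [Nat.findGreatest_succ, Nat.findGreatest_succ, ih (by omega)]
      have : Zd.prefixWalk m ξ (j + 1) = ξ (j + 1) := by simp [Zd.prefixWalk, min_eq_left hj]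
      simp only [this]
  exact key m le_rfl

/-- An odd time is never a surface visit: `lastV (j+1) = lastV j` for `j` even. [cite: BeatonBousquetMelouDeGierDuminilCopinGuttmann2014, §3.1 (arXiv v5 p. 8: contacts with the surface)] -/
theorem lastV_succ_of_even {j : ℕ} (hj : j % 2 = 0) (ξ : ℕ → Site 2) : lastV (j + 1) ξ = lastV j ξ := by
  unfold lastV
  rw [Nat.findGreatest_succ, if_neg]
  omega

/-- A prefix of a half-plane walk is a half-plane walk with the same visits up to that time. [cite: MadrasSlade1993, §1.2, (1.2.3)] -/
theorem prefixWalk_mem_hpw (hω : ω ∈ hpw n) {k : ℕ} (hk : k ≤ n) :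
    Zd.prefixWalk k ω ∈ hpw k ∧ visits k (Zd.prefixWalk k ω) = visits k ω := by
  obtain ⟨hωs, hH⟩ := mem_hpw.1 hω
  obtain ⟨h0, -, hbw, -⟩ := mem_saws_iff.1 hωs
  have hv : ∀ i ≤ k, Zd.prefixWalk k ω i = ω i := fun i hi => by simp [Zd.prefixWalk, min_eq_left hi]
  refine ⟨mem_hpw.2 ⟨mem_saws.2 ⟨Zd.prefixWalk_mem_saws (saws_subset _ hωs) hk, fun i hi => ?_⟩, fun i hi => ?_⟩,
    visits_congr fun i _ hi => by rw [hv i hi]⟩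
  · rw [hv i hi.le, hv (i + 1) (by omega)]; exact hbw i (by omega)
  · rw [hv i hi]; exact hH i (by omega)

/-! ### The end of an arch: along the row -/

/-- **The last step of an arch is ALONG the row**: `Y_{n-1} = 0` and `X_n = X_{n-1} ± 1` (the end, an even-time vertex, has no downward
bond, and the half-plane forbids `Y = 1`). [cite: EntingJensen2009, §7.4.2, Fig. 7.10 (brickwork form of the honeycomb lattice)] -/
theorem arch_last_step (hω : ω ∈ archs (n + 1)) :
    ω n 1 = 0 ∧ (ω (n + 1) 0 = ω n 0 + 1 ∨ ω n 0 = ω (n + 1) 0 + 1) := by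
  obtain ⟨hωh, hev, hend⟩ := mem_archs.1 hω
  obtain ⟨hωs, hH⟩ := mem_hpw.1 hωh
  obtain ⟨-, -, hbw, -⟩ := mem_saws_iff.1 hωs
  have s := Arm.step_cases (hbw n (by omega))
  have hp := parity_apply hωs (le_refl (n + 1))
  have hYn := hH n (by omega)
  rw [hend] at hp
  push_cast at hp
  omega

/-- **A surface vertex is left and entered ALONG the row**: if `Y_i = 0` at an even time `i < n` then `Y_{i+1} = 0` and `X_{i+1} = X_i ± 1`.
[cite: EntingJensen2009, §7.4.2, Fig. 7.10 (brickwork form of the honeycomb lattice)] -/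
theorem surface_next_step (hω : ω ∈ hpw n) {i : ℕ} (hi : i < n) (hev : i % 2 = 0) (hY : ω i 1 = 0) :
    ω (i + 1) 1 = 0 ∧ (ω (i + 1) 0 = ω i 0 + 1 ∨ ω i 0 = ω (i + 1) 0 + 1) := by
  obtain ⟨hωs, hH⟩ := mem_hpw.1 hω
  obtain ⟨-, -, hbw, -⟩ := mem_saws_iff.1 hωs
  have s := Arm.step_cases (hbw i hi)
  have hp := parity_apply hωs hi.le
  have hY1 := hH (i + 1) (by omega)
  rw [hY] at hp
  omega

/-- … and symmetrically BEFORE an even-time surface visit: `Y_{i-1} = 0`, `X_i = X_{i-1} ± 1`. [cite: EntingJensen2009, §7.4.2, Fig. 7.10] -/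
theorem surface_prev_step (hω : ω ∈ hpw n) {i : ℕ} (hi : i + 1 ≤ n) (hev : (i + 1) % 2 = 0) (hY : ω (i + 1) 1 = 0) :
    ω i 1 = 0 ∧ (ω (i + 1) 0 = ω i 0 + 1 ∨ ω i 0 = ω (i + 1) 0 + 1) := by
  obtain ⟨hωs, hH⟩ := mem_hpw.1 hω
  obtain ⟨-, -, hbw, -⟩ := mem_saws_iff.1 hωs
  have s := Arm.step_cases (hbw i (by omega))
  have hp := parity_apply hωs hi
  have hYi := hH i (by omega)
  rw [hY] at hp
  push_cast at hp
  omega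


/-! ### The fibres of the last surface visit before the end -/

open Classical in
/-- The fibre of arches of length `m+4` whose last surface visit before the end is at time `k`. [cite: HammersleyTorrieWhittington1982, §2 (unfolded surface walks, as summarised by Beaton 2014 arXiv v3 p. 11; locator provisional, source not held)] -/
def fibW (m k : ℕ) : Finset (ℕ → Site 2) := (archs (m + 4)).filter (fun ω => lastV (m + 2) ω = k)

open Classical in
/-- Anatomy of a member of the fibre. [cite: HammersleyTorrieWhittington1982, §2 (unfolded surface walks, as summarised by Beaton 2014 arXiv v3 p. 11; locator provisional, source not held)] -/
theorem fibW_anatomy {m k : ℕ} (hω : ω ∈ fibW m k) :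
    ω ∈ hpw (m + 4) ∧ m % 2 = 0 ∧ ω (m + 4) 1 = 0 ∧ k ≤ m + 2 ∧ k % 2 = 0 ∧ ω k 1 = 0 ∧
      (∀ i, k < i → i ≤ m + 2 → ¬ (i % 2 = 0 ∧ ω i 1 = 0)) ∧ lastV (m + 2) ω = k := by
  obtain ⟨hωa, hk⟩ := Finset.mem_filter.1 hω
  obtain ⟨hωh, hev, hend⟩ := mem_archs.1 hωa
  obtain ⟨h0, -, -, -⟩ := mem_saws_iff.1 (hpw_subset hωh)
  obtain ⟨hk2, hkY⟩ := lastV_spec (n := m + 2) (ω := ω) h0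
  rw [hk] at hk2 hkY
  refine ⟨hωh, by omega, hend, hk ▸ lastV_le _ _, hk2, hkY, fun i hi1 hi2 => ?_, hk⟩
  exact not_visit_of_lastV_lt (n := m + 2) (by rw [hk]; exact hi1) hi2

open Classical in
/-- **The straight fibre `k = m+2` is FORCED**: `(2s,0) (2s±1,0) (2s±2,0)` continuing the direction of arrival; weight `≤ y · A_{m+2}(y)`.
[cite: BeatonBousquetMelouDeGierDuminilCopinGuttmann2014, §3.1 (arXiv v5 p. 9: walks sticking to the surface); EntingJensen2009, §7.4.2, Fig. 7.10] -/
theorem sum_fibW_self_le (m : ℕ) (hy : 0 ≤ y) : ∑ ω ∈ fibW m (m + 2), y ^ visits (m + 4) ω ≤ y * Aw (m + 2) y := by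
  set g : (ℕ → Site 2) → (ℕ → Site 2) := fun ω => Zd.prefixWalk (m + 2) ω with hg
  have hcoord : ∀ ω ∈ fibW m (m + 2), ω (m + 3) 0 = 2 * ω (m + 2) 0 - ω (m + 1) 0 ∧ ω (m + 3) 1 = 0 ∧
      ω (m + 4) 0 = 2 * ω (m + 3) 0 - ω (m + 2) 0 ∧ ω (m + 4) 1 = 0 := by
    intro ω hω
    obtain ⟨hωh, hm, hend, -, -, hkY, -, -⟩ := fibW_anatomy hω
    obtain ⟨hωs, -⟩ := mem_hpw.1 hωh
    obtain ⟨-, -, -, hinj⟩ := mem_saws_iff.1 hωs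
    have hωa : ω ∈ archs (m + 3 + 1) := by
      rw [show m + 3 + 1 = m + 4 by omega]; exact (Finset.mem_filter.1 hω).1
    obtain ⟨hY3, hX4⟩ := arch_last_step hωa
    obtain ⟨-, hX3⟩ := surface_next_step hωh (i := m + 2) (by omega) (by omega) hkY
    obtain ⟨hY1, hX1⟩ := surface_prev_step hωh (i := m + 1) (by omega) (by omega)
      (by rw [show m + 1 + 1 = m + 2 by omega]; exact hkY)
    rw [show m + 2 + 1 = m + 3 by omega] at hX3
    rw [show m + 1 + 1 = m + 2 by omega] at hX1
    rw [show m + 3 + 1 = m + 4 by omega] at hX4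
    have hne13 : ω (m + 1) ≠ ω (m + 3) := fun h => by
      have := hinj (show m + 1 ∈ {j | j ≤ m + 4} by simp only [Set.mem_setOf_eq]; omega)
        (show m + 3 ∈ {j | j ≤ m + 4} by simp only [Set.mem_setOf_eq]; omega) h
      omega
    have hne24 : ω (m + 2) ≠ ω (m + 4) := fun h => by
      have := hinj (show m + 2 ∈ {j | j ≤ m + 4} by simp only [Set.mem_setOf_eq]; omega)
        (show m + 4 ∈ {j | j ≤ m + 4} by simp only [Set.mem_setOf_eq]; exact le_rfl) h
      omega
    have hne13' : ω (m + 1) 0 ≠ ω (m + 3) 0 := fun h => hne13 ((site_two_eq_iff _ _).2 ⟨h, by rw [hY1, hY3]⟩)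
    have hne24' : ω (m + 2) 0 ≠ ω (m + 4) 0 := fun h => hne24 ((site_two_eq_iff _ _).2 ⟨h, by rw [hkY, hend]⟩)
    refine ⟨by omega, hY3, by omega, hend⟩
  have hprops : ∀ ω ∈ fibW m (m + 2), g ω ∈ archs (m + 2) ∧ visits (m + 4) ω = visits (m + 2) (g ω) + 1 := by
    intro ω hω
    obtain ⟨hωh, hm, hend, -, -, hkY, -, -⟩ := fibW_anatomy hω
    obtain ⟨hpa, hpv⟩ := prefixWalk_mem_archs hωh (show m + 2 ≤ m + 4 by omega) (by omega) hkY
    refine ⟨hpa, ?_⟩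
    rw [show m + 4 = m + 3 + 1 by omega, visits_succ, show m + 3 = m + 2 + 1 by omega, visits_succ, hpv]
    have h3 : ¬ ((m + 2 + 1) % 2 = 0 ∧ ω (m + 2 + 1) 1 = 0) := fun h => by omega
    have h4 : (m + 2 + 1 + 1) % 2 = 0 ∧ ω (m + 2 + 1 + 1) 1 = 0 :=
      ⟨by omega, by rw [show m + 2 + 1 + 1 = m + 4 by omega]; exact hend⟩
    rw [if_neg h3, if_pos h4]
  have hinj : Set.InjOn g ↑(fibW m (m + 2)) := by
    intro ω hω ω' hω' h
    rw [Finset.mem_coe] at hω hω'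
    have hc := hcoord ω hω
    have hc' := hcoord ω' hω'
    have hωs := hpw_subset (fibW_anatomy hω).1
    have hωs' := hpw_subset (fibW_anatomy hω').1
    have hagree : ∀ i ≤ m + 2, ω i = ω' i := fun i hi => by
      have := congrFun h i
      simpa [hg, Zd.prefixWalk, min_eq_left hi] using this
    have e1 : ω (m + 1) 0 = ω' (m + 1) 0 := by rw [hagree (m + 1) (by omega)]
    have e2 : ω (m + 2) 0 = ω' (m + 2) 0 := by rw [hagree (m + 2) le_rfl]
    refine eq_of_agree_aux hωs hωs' fun i hi => ?_
    rcases Nat.lt_or_ge i (m + 3) with hi' | hi'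
    · exact hagree i (by omega)
    · rw [site_two_eq_iff]
      obtain ⟨a0, a1, b0, b1⟩ := hc
      obtain ⟨a0', a1', b0', b1'⟩ := hc'
      have hcase : i = m + 3 ∨ i = m + 4 := by omega
      rcases hcase with rfl | rfl
      · exact ⟨by rw [a0, a0', e1, e2], by rw [a1, a1']⟩
      · exact ⟨by rw [b0, b0', a0, a0', e1, e2], by rw [b1, b1']⟩
  calc ∑ ω ∈ fibW m (m + 2), y ^ visits (m + 4) ω = ∑ ω ∈ fibW m (m + 2), y * y ^ visits (m + 2) (g ω) :=
        Finset.sum_congr rfl fun ω hω => by rw [(hprops ω hω).2, pow_succ, mul_comm]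
    _ = y * ∑ ξ ∈ (fibW m (m + 2)).image g, y ^ visits (m + 2) ξ := by rw [Finset.mul_sum, Finset.sum_image hinj]
    _ ≤ y * Aw (m + 2) y := by
        refine mul_le_mul_of_nonneg_left ?_ hy
        rw [Aw]
        refine Finset.sum_le_sum_of_subset_of_nonneg (fun ξ hξ => ?_) fun _ _ _ => pow_nonneg hy _
        obtain ⟨ω, hω, rfl⟩ := Finset.mem_image.1 hξ
        exact (hprops ω hω).1

open Classical in
/-- **Every fibre `k`**: weight `≤ 2y · A_k(y) · c_{m+3-k}(ℍ)` — drop the last step (two possible directions along the row), then S1's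
prefix / suffix split of the `(m+3)`-prefix at its last surface visit `k`. [cite: HammersleyTorrieWhittington1982, §2 (as summarised by Beaton 2014 arXiv v3 p. 11; locator provisional); MadrasSlade1993, §1.2, (1.2.3)] -/
theorem sum_fibW_le (m : ℕ) (hy : 0 ≤ y) {k : ℕ} (hk : k ≤ m + 2) :
    ∑ ω ∈ fibW m k, y ^ visits (m + 4) ω ≤ 2 * y * (Aw k y * #(saws (m + 3 - k))) := by
  set F := (hpw (m + 3)).filter (fun ξ => lastV (m + 3) ξ = k) with hF
  set g : (ℕ → Site 2) → (ℕ → Site 2) × Bool :=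
    fun ω => (Zd.prefixWalk (m + 3) ω, decide (ω (m + 4) 0 = ω (m + 3) 0 + 1)) with hg
  have hprops : ∀ ω ∈ fibW m k, (g ω).1 ∈ F ∧ visits (m + 4) ω = visits (m + 3) (g ω).1 + 1 := by
    intro ω hω
    obtain ⟨hωh, hm, hend, -, -, -, -, hlast⟩ := fibW_anatomy hω
    obtain ⟨hph, hpv⟩ := prefixWalk_mem_hpw hωh (show m + 3 ≤ m + 4 by omega)
    have hl3 : lastV (m + 3) ω = k := by
      rw [show m + 3 = m + 2 + 1 by omega, lastV_succ_of_even (by omega), hlast]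
    refine ⟨Finset.mem_filter.2 ⟨hph, (lastV_prefixWalk_eq _ _).trans hl3⟩, ?_⟩
    rw [show m + 4 = m + 3 + 1 by omega, visits_succ, hpv]
    have h4 : (m + 3 + 1) % 2 = 0 ∧ ω (m + 3 + 1) 1 = 0 := ⟨by omega, by rw [show m + 3 + 1 = m + 4 by omega]; exact hend⟩
    rw [if_pos h4]
  have hinj : Set.InjOn g ↑(fibW m k) := by
    intro ω hω ω' hω' h
    rw [Finset.mem_coe] at hω hω'
    obtain ⟨hωh, -, hend, -⟩ := fibW_anatomy hω
    obtain ⟨hωh', -, hend', -⟩ := fibW_anatomy hω'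
    have hωs := hpw_subset hωh
    have hωs' := hpw_subset hωh'
    simp only [hg, Prod.mk.injEq] at h
    obtain ⟨h1, h2⟩ := h
    have hagree : ∀ i ≤ m + 3, ω i = ω' i := fun i hi => by
      have := congrFun h1 i
      simpa [Zd.prefixWalk, min_eq_left hi] using this
    have hωa : ω ∈ archs (m + 3 + 1) := by rw [show m + 3 + 1 = m + 4 by omega]; exact (Finset.mem_filter.1 hω).1
    have hωa' : ω' ∈ archs (m + 3 + 1) := by rw [show m + 3 + 1 = m + 4 by omega]; exact (Finset.mem_filter.1 hω').1
    obtain ⟨-, hX⟩ := arch_last_step hωa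
    obtain ⟨-, hX'⟩ := arch_last_step hωa'
    rw [show m + 3 + 1 = m + 4 by omega] at hX hX'
    have e3 : ω (m + 3) 0 = ω' (m + 3) 0 := by rw [hagree (m + 3) le_rfl]
    have hb : (ω (m + 4) 0 = ω (m + 3) 0 + 1) ↔ (ω' (m + 4) 0 = ω' (m + 3) 0 + 1) := by
      simpa using h2
    refine eq_of_agree_aux hωs hωs' fun i hi => ?_
    rcases Nat.lt_or_ge i (m + 4) with hi' | hi'
    · exact hagree i (by omega)
    · have hin : i = m + 4 := le_antisymm hi hi'
      rw [hin, site_two_eq_iff]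
      refine ⟨?_, by rw [hend, hend']⟩
      rcases hX with hX | hX <;> rcases hX' with hX' | hX'
      · omega
      · exact absurd (hb.1 hX) (by omega)
      · exact absurd (hb.2 hX') (by omega)
      · omega
  calc ∑ ω ∈ fibW m k, y ^ visits (m + 4) ω = ∑ ω ∈ fibW m k, y * y ^ visits (m + 3) (g ω).1 :=
        Finset.sum_congr rfl fun ω hω => by rw [(hprops ω hω).2, pow_succ, mul_comm]
    _ = ∑ p ∈ (fibW m k).image g, y * y ^ visits (m + 3) p.1 := by rw [Finset.sum_image hinj]
    _ ≤ ∑ p ∈ F ×ˢ (Finset.univ : Finset Bool), y * y ^ visits (m + 3) p.1 := by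
        refine Finset.sum_le_sum_of_subset_of_nonneg (fun p hp => ?_) fun _ _ _ => mul_nonneg hy (pow_nonneg hy _)
        obtain ⟨ω, hω, rfl⟩ := Finset.mem_image.1 hp
        exact Finset.mem_product.2 ⟨(hprops ω hω).1, Finset.mem_univ _⟩
    _ = 2 * y * ∑ ξ ∈ F, y ^ visits (m + 3) ξ := by
        rw [Finset.sum_product, Finset.mul_sum]
        refine Finset.sum_congr rfl fun ξ _ => ?_
        simp only [Finset.sum_const, Finset.card_univ, Fintype.card_bool, nsmul_eq_mul]
        push_cast
        ring
    _ ≤ 2 * y * (Aw k y * #(saws (m + 3 - k))) :=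
        mul_le_mul_of_nonneg_left (sum_fibre_lastV_le (n := m + 3) hy (by omega)) (by positivity)

open Classical in
/-- `A_{m+4}` is the sum of its fibres. [cite: HammersleyTorrieWhittington1982, §2 (unfolded surface walks, as summarised by Beaton 2014 arXiv v3 p. 11; locator provisional, source not held)] -/
theorem Aw_eq_sum_fibW (m : ℕ) (y : ℝ) : Aw (m + 4) y = ∑ k ∈ range (m + 3), ∑ ω ∈ fibW m k, y ^ visits (m + 4) ω := by
  have hf : ∀ ω ∈ archs (m + 4), lastV (m + 2) ω ∈ range (m + 3) :=
    fun ω _ => Finset.mem_range.2 (Nat.lt_succ_of_le (lastV_le _ _))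
  rw [Aw, ← Finset.sum_fiberwise_of_maps_to hf]
  rfl

/-- **The recursion** (`y ≥ 0`): `A_{m+4}(y) ≤ y · A_{m+2}(y) + 2y · Σ_{k ≤ m+1} A_k(y) · c_{m+3-k}(ℍ)`.
[cite: HammersleyTorrieWhittington1982, §2 (as summarised by Beaton 2014 arXiv v3 p. 11; locator provisional); MadrasSlade1993, §1.2, (1.2.3)] -/
theorem Aw_le_rec (m : ℕ) (hy : 0 ≤ y) :
    Aw (m + 4) y ≤ y * Aw (m + 2) y + 2 * y * ∑ k ∈ range (m + 2), Aw k y * #(saws (m + 3 - k)) := by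
  rw [Aw_eq_sum_fibW, Finset.sum_range_succ]
  have h1 : ∑ k ∈ range (m + 2), ∑ ω ∈ fibW m k, y ^ visits (m + 4) ω ≤
      2 * y * ∑ k ∈ range (m + 2), Aw k y * #(saws (m + 3 - k)) := by
    rw [Finset.mul_sum]
    exact Finset.sum_le_sum fun k hk => sum_fibW_le m hy (by have := Finset.mem_range.1 hk; omega)
  have h2 := sum_fibW_self_le m hy
  linarith

/-! ### The growth bound and the rate -/

/-- Geometric comparison `Σ_{k ≤ m} ρ^k 3^{m+s-k} ≤ 2·3^s ρ^m` for `ρ ≥ 6` (private twin). [cite: MadrasSlade1993, §1.2, Lemma 1.2.2] -/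
private theorem sum_pow_mul_three_pow_le_aux {ρ : ℝ} (hρ : 6 ≤ ρ) (m s : ℕ) :
    ∑ k ∈ range (m + 1), ρ ^ k * (3 : ℝ) ^ (m + s - k) ≤ 2 * 3 ^ s * ρ ^ m := by
  have hρ0 : 0 < ρ := by linarith
  have hq0 : (0 : ℝ) ≤ 3 / ρ := by positivity
  have hq : (3 : ℝ) / ρ ≤ 1 / 2 := by rw [div_le_div_iff₀ hρ0 (by norm_num : (0:ℝ) < 2)]; linarith
  have hterm : ∀ k ∈ range (m + 1), ρ ^ k * (3 : ℝ) ^ (m + s - k) = 3 ^ s * ρ ^ m * (3 / ρ) ^ (m - k) := by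
    intro k hk
    have hkm : k ≤ m := Nat.lt_succ_iff.1 (Finset.mem_range.1 hk)
    have hρm : ρ ^ m = ρ ^ k * ρ ^ (m - k) := by rw [← pow_add, Nat.add_sub_cancel' hkm]
    rw [show m + s - k = s + (m - k) by omega, pow_add, div_pow, hρm]
    field_simp
  calc ∑ k ∈ range (m + 1), ρ ^ k * (3 : ℝ) ^ (m + s - k) = ∑ k ∈ range (m + 1), 3 ^ s * ρ ^ m * (3 / ρ) ^ (m - k) :=
        Finset.sum_congr rfl hterm
    _ = 3 ^ s * ρ ^ m * ∑ k ∈ range (m + 1), (3 / ρ) ^ (m - k) := by rw [Finset.mul_sum]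
    _ = 3 ^ s * ρ ^ m * ∑ k ∈ range (m + 1), (3 / ρ) ^ k := by
        congr 1
        have := Finset.sum_range_reflect (fun k => (3 / ρ : ℝ) ^ k) (m + 1)
        rw [← this]
        refine Finset.sum_congr rfl fun k hk => ?_
        rw [show m + 1 - 1 - k = m - k by omega]
    _ ≤ 3 ^ s * ρ ^ m * ∑ k ∈ range (m + 1), (1 / 2 : ℝ) ^ k := by gcongr
    _ ≤ 3 ^ s * ρ ^ m * 2 := by gcongr; exact sum_geometric_two_le _
    _ = 2 * 3 ^ s * ρ ^ m := by ring

/-- **The growth bound** (`y ≥ 1`): if `ρ ≥ 6` and `y/ρ² + 36 y/ρ³ ≤ 1` then `A_n(y) ≤ 27 y³ · ρⁿ` for every `n`.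
[cite: HammersleyTorrieWhittington1982, §2 (as summarised by Beaton 2014 arXiv v3 p. 11; locator provisional); MadrasSlade1993, §1.2, Lemma 1.2.2] -/
theorem Aw_le_mul_pow (hy : 1 ≤ y) {ρ : ℝ} (hρ : 6 ≤ ρ) (hc : y / ρ ^ 2 + 36 * y / ρ ^ 3 ≤ 1) (n : ℕ) :
    Aw n y ≤ 27 * y ^ 3 * ρ ^ n := by
  have hy0 : 0 ≤ y := by linarith
  have hρ1 : 1 ≤ ρ := by linarith
  have hρ0 : 0 < ρ := by linarith
  induction n using Nat.strong_induction_on with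
  | _ n ih =>
  rcases Nat.lt_or_ge n 4 with hn | hn
  · have h1 := Aw_le_card_mul_pow n hy0
    rw [max_eq_right hy] at h1
    have h2 : (#(saws n) : ℝ) * y ^ n ≤ 3 ^ n * y ^ n :=
      mul_le_mul_of_nonneg_right (card_saws_le_three_pow_aux n) (pow_nonneg hy0 _)
    have h3 : (3 : ℝ) ^ n ≤ 27 := by
      calc (3 : ℝ) ^ n ≤ 3 ^ 3 := pow_le_pow_right₀ (by norm_num) (by omega)
        _ = 27 := by norm_num
    have h4 : y ^ n ≤ y ^ 3 := pow_le_pow_right₀ hy (by omega)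
    have h5 : (1 : ℝ) ≤ ρ ^ n := one_le_pow₀ hρ1
    calc Aw n y ≤ 3 ^ n * y ^ n := h1.trans h2
      _ ≤ 27 * y ^ 3 := mul_le_mul h3 h4 (pow_nonneg hy0 _) (by norm_num)
      _ = 27 * y ^ 3 * 1 := (mul_one _).symm
      _ ≤ 27 * y ^ 3 * ρ ^ n := mul_le_mul_of_nonneg_left h5 (by positivity)
  · obtain ⟨m, rfl⟩ : ∃ m, n = m + 4 := ⟨n - 4, by omega⟩
    set M : ℝ := 27 * y ^ 3 with hM
    have hM0 : 0 ≤ M := by positivity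
    have hrec := Aw_le_rec m hy0
    have b2 : Aw (m + 2) y ≤ M * ρ ^ (m + 2) := ih (m + 2) (by omega)
    have bS : ∑ k ∈ range (m + 2), Aw k y * (#(saws (m + 3 - k)) : ℝ) ≤ M * (18 * ρ ^ (m + 1)) := by
      calc ∑ k ∈ range (m + 2), Aw k y * (#(saws (m + 3 - k)) : ℝ)
          ≤ ∑ k ∈ range (m + 2), M * ρ ^ k * 3 ^ (m + 1 + 2 - k) := by
            refine Finset.sum_le_sum fun k hk => ?_
            rw [show m + 1 + 2 - k = m + 3 - k by omega]
            exact mul_le_mul (ih k (by have := Finset.mem_range.1 hk; omega)) (card_saws_le_three_pow_aux _)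
              (by positivity) (by positivity)
        _ = M * ∑ k ∈ range (m + 1 + 1), ρ ^ k * 3 ^ (m + 1 + 2 - k) := by
            rw [show m + 2 = m + 1 + 1 by omega, Finset.mul_sum]; exact Finset.sum_congr rfl fun k _ => by ring
        _ ≤ M * (2 * 3 ^ 2 * ρ ^ (m + 1)) := mul_le_mul_of_nonneg_left (sum_pow_mul_three_pow_le_aux hρ (m + 1) 2) hM0
        _ = M * (18 * ρ ^ (m + 1)) := by norm_num
    have key : y * ρ ^ (m + 2) + 36 * y * ρ ^ (m + 1) ≤ ρ ^ (m + 4) := by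
      have h := mul_le_mul_of_nonneg_right hc (pow_nonneg hρ0.le (m + 4))
      rw [one_mul] at h
      have e : (y / ρ ^ 2 + 36 * y / ρ ^ 3) * ρ ^ (m + 4) = y * ρ ^ (m + 2) + 36 * y * ρ ^ (m + 1) := by
        field_simp
        ring
      linarith
    have c1 : y * Aw (m + 2) y ≤ y * (M * ρ ^ (m + 2)) := mul_le_mul_of_nonneg_left b2 hy0
    have c2 : 2 * y * ∑ k ∈ range (m + 2), Aw k y * (#(saws (m + 3 - k)) : ℝ) ≤ 2 * y * (M * (18 * ρ ^ (m + 1))) :=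
      mul_le_mul_of_nonneg_left bS (by positivity)
    have key' := mul_le_mul_of_nonneg_left key hM0
    calc Aw (m + 4) y ≤ y * Aw (m + 2) y + 2 * y * ∑ k ∈ range (m + 2), Aw k y * (#(saws (m + 3 - k)) : ℝ) := hrec
      _ ≤ y * (M * ρ ^ (m + 2)) + 2 * y * (M * (18 * ρ ^ (m + 1))) := add_le_add c1 c2
      _ = M * (y * ρ ^ (m + 2) + 36 * y * ρ ^ (m + 1)) := by ring
      _ ≤ M * ρ ^ (m + 4) := key'

/-- **Fekete transfer**: `B^w_m(y) ≤ M ρᵐ` for all `m` gives `β(y) ≤ ρ`. [cite: MadrasSlade1993, §1.2, Lemma 1.2.2 and (1.2.17)] -/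
theorem wallRate_le_of_WB_le (hy : 0 < y) {M ρ : ℝ} (hM : 0 < M) (hρ : 0 < ρ) (h : ∀ n, WB n y ≤ M * ρ ^ n) :
    wallRate y ≤ ρ := by
  have hlim := tendsto_wallU_div hy
  have hb : Tendsto (fun k : ℕ => (-Real.log (y * M) + 2 * Real.log ρ) / (k : ℝ) - 2 * Real.log ρ) atTop
      (𝓝 (0 - 2 * Real.log ρ)) :=
    (tendsto_const_div_atTop_nhds_zero_nat _).sub tendsto_const_nhds
  rw [zero_sub] at hb
  have hle : ∀ᶠ k : ℕ in atTop, (-Real.log (y * M) + 2 * Real.log ρ) / (k : ℝ) - 2 * Real.log ρ ≤ wallU y k / k := by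
    filter_upwards [eventually_ge_atTop 1] with k hk
    have hk0 : (0 : ℝ) < k := by exact_mod_cast hk
    have hpos := wallSeq_pos hy k
    have h1 : wallSeq y k ≤ y * M * ρ ^ (2 * k - 2) := by
      rw [wallSeq, if_neg (by omega), mul_assoc]
      exact mul_le_mul_of_nonneg_left (h _) hy.le
    have h2 : Real.log (wallSeq y k) ≤ Real.log (y * M) + ((2 * k - 2 : ℕ) : ℝ) * Real.log ρ := by
      calc Real.log (wallSeq y k) ≤ Real.log (y * M * ρ ^ (2 * k - 2)) := Real.log_le_log hpos h1
        _ = Real.log (y * M) + ((2 * k - 2 : ℕ) : ℝ) * Real.log ρ := by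
            rw [Real.log_mul (mul_pos hy hM).ne' (pow_ne_zero _ hρ.ne'), Real.log_pow]
    have hcast : ((2 * k - 2 : ℕ) : ℝ) = 2 * k - 2 := by
      rw [Nat.cast_sub (by omega)]; push_cast; ring
    rw [hcast] at h2
    rw [wallU, le_div_iff₀ hk0]
    have e : ((-Real.log (y * M) + 2 * Real.log ρ) / (k : ℝ) - 2 * Real.log ρ) * k =
        -Real.log (y * M) - (2 * k - 2) * Real.log ρ := by
      field_simp
      ring
    rw [e]
    linarith
  have hge : -(2 * Real.log ρ) ≤ wallLogLim y := le_of_tendsto_of_tendsto hb hlim hle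
  rw [wallRate]
  calc Real.exp (-(wallLogLim y) / 2) ≤ Real.exp (Real.log ρ) := Real.exp_le_exp.2 (by linarith)
    _ = ρ := Real.exp_log hρ

/-- **`β(y) ≤ √y / (1 − 36/√y)` for `y > 36²`.** [cite: BeatonBousquetMelouDeGierDuminilCopinGuttmann2014, §3.1 (arXiv v5 p. 10: "This translates into μ(y) ∼ √y in our honeycomb setting" — stated without proof; Proposition 5 p. 9 prints the lower side); RychlewskiWhittington2011, Theorem (square-lattice analogue "μ(y) is asymptotic to y"; not held)] -/
theorem wallRate_le_sqrt_div (hy : (36 : ℝ) ^ 2 < y) : wallRate y ≤ Real.sqrt y / (1 - 36 / Real.sqrt y) := by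
  set s := Real.sqrt y with hs
  have hy0 : 0 < y := lt_trans (by norm_num) hy
  have hs36 : 36 < s := by
    rw [hs, ← Real.sqrt_sq (by norm_num : (0 : ℝ) ≤ 36)]
    exact Real.sqrt_lt_sqrt (by positivity) hy
  have hs0 : 0 < s := by linarith
  have hsy : s ^ 2 = y := by rw [hs]; exact Real.sq_sqrt hy0.le
  have hy1 : 1 ≤ y := by nlinarith
  set q := 36 / s with hq
  have hq1 : q < 1 := by rw [hq, div_lt_one hs0]; exact hs36
  have h1q : 0 < 1 - q := by linarith
  have hq0 : 0 < q := by positivity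
  have h1q' : 1 - q ≤ 1 := by linarith
  set ρ := s / (1 - q) with hρdef
  have hρs : s ≤ ρ := by
    rw [hρdef, le_div_iff₀ h1q]
    nlinarith
  have hρ6 : 6 ≤ ρ := by linarith
  have hρ0 : 0 < ρ := by linarith
  have hc : y / ρ ^ 2 + 36 * y / ρ ^ 3 ≤ 1 := by
    have p3 : s ^ 3 ≤ ρ ^ 3 := pow_le_pow_left₀ hs0.le hρs 3
    have t1 : y / ρ ^ 2 ≤ 1 - q := by
      have e : y / ρ ^ 2 = (1 - q) ^ 2 := by
        rw [hρdef, div_pow, ← hsy]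
        field_simp
      rw [e]
      calc (1 - q) ^ 2 ≤ (1 - q) ^ 1 := pow_le_pow_of_le_one h1q.le h1q' (by norm_num)
        _ = 1 - q := pow_one _
    have t2 : 36 * y / ρ ^ 3 ≤ 36 / s := by
      rw [div_le_div_iff₀ (by positivity) hs0, ← hsy]
      nlinarith
    have hsum : 36 / s = q := by rw [hq]
    linarith
  have hA := Aw_le_mul_pow hy1 hρ6 hc
  have hW : ∀ n, WB n y ≤ 27 * y ^ 3 * ρ ^ n := fun n => (WB_le_Aw n hy0.le).trans (hA n)
  exact wallRate_le_of_WB_le hy0 (by positivity) hρ0 hW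

/-- The same bound without the quotient: `β(y) · (1 − 36/√y) ≤ √y`. [cite: BeatonBousquetMelouDeGierDuminilCopinGuttmann2014, §3.1, Proposition 5 (arXiv v5 p. 9)] -/
theorem wallRate_mul_le_sqrt (hy : (36 : ℝ) ^ 2 < y) : wallRate y * (1 - 36 / Real.sqrt y) ≤ Real.sqrt y := by
  have hs36 : 36 < Real.sqrt y := by
    rw [← Real.sqrt_sq (by norm_num : (0 : ℝ) ≤ 36)]
    exact Real.sqrt_lt_sqrt (by positivity) hy
  have h1q : 0 < 1 - 36 / Real.sqrt y := by
    have : 36 / Real.sqrt y < 1 := (div_lt_one (by linarith)).2 hs36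
    linarith
  exact (le_div_iff₀ h1q).1 (wallRate_le_sqrt_div hy)

/-! ### The lower bound `√y ≤ β(y)` and the limit -/

/-- `y ≤ B^w_2(y)`: the straight two-step walk along the surface is a wall bridge with one surface visit.
[cite: BeatonBousquetMelouDeGierDuminilCopinGuttmann2014, §3.1 (arXiv v5 p. 9: walks sticking to the surface)] -/
theorem le_WB_two (hy : 0 < y) : y ≤ WB 2 y := by
  have hmem := straightWalk_mem_wbr 1
  rw [show 2 * 1 = 2 by norm_num] at hmem
  have hv : visits 2 (Zd.straightWalk 2 2) = 1 := by
    have e1 : visits 1 (Zd.straightWalk 2 2) = visits 0 (Zd.straightWalk 2 2) +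
        (if (0 + 1) % 2 = 0 ∧ Zd.straightWalk 2 2 (0 + 1) 1 = 0 then 1 else 0) := visits_succ 0 _
    have e2 : visits 2 (Zd.straightWalk 2 2) = visits 1 (Zd.straightWalk 2 2) +
        (if (1 + 1) % 2 = 0 ∧ Zd.straightWalk 2 2 (1 + 1) 1 = 0 then 1 else 0) := visits_succ 1 _
    rw [e2, e1, visits_zero]
    simp only [straightWalk_apply_one]
    norm_num
  rw [WB]
  calc y = y ^ visits 2 (Zd.straightWalk 2 2) := by rw [hv, pow_one]
    _ ≤ ∑ ω ∈ wbr 2, y ^ visits 2 ω := Finset.single_le_sum (fun _ _ => pow_nonneg hy.le _) hmem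

/-- **`√y ≤ β(y)`** (`y ≤ B^w_2 ≤ (β²/y) β²`). [cite: BeatonBousquetMelouDeGierDuminilCopinGuttmann2014, §3.1, Proposition 5 (arXiv v5 p. 9)] -/
theorem sqrt_le_wallRate (hy : 0 < y) : Real.sqrt y ≤ wallRate y := by
  have hβ := wallRate_pos y
  have h := WB_le_pow hy 2
  have h1 : y ^ 2 ≤ (wallRate y ^ 2) ^ 2 := by
    have h2 : y ≤ wallRate y ^ 2 / y * wallRate y ^ 2 := (le_WB_two hy).trans h
    rw [div_mul_eq_mul_div, le_div_iff₀ hy] at h2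
    nlinarith
  have h2 : y ≤ wallRate y ^ 2 := (pow_le_pow_iff_left₀ hy.le (sq_nonneg _) two_ne_zero).1 h1
  calc Real.sqrt y ≤ Real.sqrt (wallRate y ^ 2) := Real.sqrt_le_sqrt h2
    _ = wallRate y := Real.sqrt_sq hβ.le

/-- **`1 ≤ β(y)/√y`** for `y > 0`. [cite: BeatonBousquetMelouDeGierDuminilCopinGuttmann2014, §3.1, Proposition 5 (arXiv v5 p. 9)] -/
theorem one_le_wallRate_div_sqrt (hy : 0 < y) : 1 ≤ wallRate y / Real.sqrt y :=
  (one_le_div (Real.sqrt_pos.2 hy)).2 (sqrt_le_wallRate hy)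

/-- **`β(y)/√y ≤ 1/(1 − 36/√y)`** for `y > 36²`. [cite: BeatonBousquetMelouDeGierDuminilCopinGuttmann2014, §3.1, Proposition 5 (arXiv v5 p. 9)] -/
theorem wallRate_div_sqrt_le (hy : (36 : ℝ) ^ 2 < y) : wallRate y / Real.sqrt y ≤ 1 / (1 - 36 / Real.sqrt y) := by
  have hs0 : 0 < Real.sqrt y := Real.sqrt_pos.2 (lt_trans (by norm_num) hy)
  rw [div_le_iff₀ hs0]
  calc wallRate y ≤ Real.sqrt y / (1 - 36 / Real.sqrt y) := wallRate_le_sqrt_div hy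
    _ = 1 / (1 - 36 / Real.sqrt y) * Real.sqrt y := by ring

/-- **`β(y)/√y → 1` as `y → ∞`**: the adsorbed phase at the Duminil-Copin–Smirnov surface is entropy-free at leading order — BBdGDCG's remark
"This translates into `μ(y) ∼ √y` in our honeycomb setting", PROVED. [cite: BeatonBousquetMelouDeGierDuminilCopinGuttmann2014, §3.1 (arXiv v5 p. 10: "This translates into μ(y) ∼ √y in our honeycomb setting"); RychlewskiWhittington2011, Theorem (square-lattice analogue; not held)] -/
theorem tendsto_wallRate_div_sqrt : Tendsto (fun y : ℝ => wallRate y / Real.sqrt y) atTop (𝓝 1) := by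
  have hup : Tendsto (fun y : ℝ => 1 / (1 - 36 / Real.sqrt y)) atTop (𝓝 1) := by
    have h1 : Tendsto (fun y : ℝ => 36 / Real.sqrt y) atTop (𝓝 0) := by
      have h := (tendsto_inv_atTop_zero.comp Real.tendsto_sqrt_atTop).const_mul 36
      rw [mul_zero] at h
      refine h.congr fun y => ?_
      simp only [Function.comp, div_eq_mul_inv]
    have h2 : Tendsto (fun y : ℝ => 1 - 36 / Real.sqrt y) atTop (𝓝 (1 - 0)) := tendsto_const_nhds.sub h1
    rw [sub_zero] at h2
    have h3 := h2.inv₀ one_ne_zero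
    rw [inv_one] at h3
    refine h3.congr fun y => ?_
    simp only [one_div]
  refine tendsto_of_tendsto_of_tendsto_of_le_of_le' tendsto_const_nhds hup ?_ ?_
  · filter_upwards [eventually_gt_atTop (0 : ℝ)] with y hy using one_le_wallRate_div_sqrt hy
  · filter_upwards [eventually_gt_atTop ((36 : ℝ) ^ 2)] with y hy using wallRate_div_sqrt_le hy

/-- **`log β(y) − ½ log y → 0`.** [cite: BeatonBousquetMelouDeGierDuminilCopinGuttmann2014, §3.1, Proposition 5 (arXiv v5 p. 9)] -/
theorem tendsto_log_wallRate_sub_half_log : Tendsto (fun y : ℝ => Real.log (wallRate y) - Real.log y / 2) atTop (𝓝 0) := by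
  have h := ((Real.continuousAt_log one_ne_zero).tendsto.comp tendsto_wallRate_div_sqrt)
  rw [Real.log_one] at h
  refine h.congr' ?_
  filter_upwards [eventually_gt_atTop (0 : ℝ)] with y hy
  simp only [Function.comp_def]
  rw [Real.log_div (wallRate_pos y).ne' (Real.sqrt_pos.2 hy).ne', Real.log_sqrt hy.le]

end Literature.Probability.RandomPlanarGeometry.SAW.HexBW.Wall
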